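import Summits.MatrixMultiplication.OmegaCensus.DominoZpZpCells
import Summits.MatrixMultiplication.OmegaCensus.DominoZ11Z11Cover5A
import Summits.MatrixMultiplication.OmegaCensus.DominoZ11Z11Cover5B
import Summits.MatrixMultiplication.OmegaCensus.DominoZ11Z11Cover5C
import Summits.MatrixMultiplication.OmegaCensus.DominoZ11Z11Cover5D
import Summits.MatrixMultiplication.OmegaCensus.DominoZ11Z11Cover5E
import HarnessLib

/-!
# No domino cube law with a part of size `3`, `4` or `5` over any `A ↠ ℤ_11 × ℤ_11`

ω-census `pub-omega`, family (b3), seat pub-omega-group gen 20.  Framing: lottery ticket; floor = certified bounds/negative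
ranges.  VALUE: kernel theorems of the `ℤ_p²`-quotient column (`p = 11`) of the Dih-side mod-one classification — the census
cells `(1,4,10)@121`, `(1,5,8)@121`, `(1,3,94)@847` and every larger order, any `c₀` — as instances of the
generic `DominoZpZpCells.lean` (cover hypotheses from the kernel enumerations `exists_table_entry_11_d`, certified line
tables `tableZ11d…`, half `η = 6`: `6 + 6 = 1` in `ZMod 11`); NOT progress on ω.

* `no_law_cube_1de_of_onto_z11z11` / `no_law_cube_1d_e_of_onto_z11z11` — parts `d ∈ {3, 4, 5}` in `T` / in `U`;
* the named cells `no_law_cube_1de_of_onto_z11z11` and `no_law_cube_1dd_of_onto_z11z11`.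
-/

namespace Summit.MatrixMultiplication.OmegaCensus

open Finset ZpZpDomino Literature.Combinatorics.Additive

variable {A : Type} [AddCommGroup A] [DecidableEq A] [Fintype A] {G : Type} [Group G] [DecidableEq G]
  {ρ τ : A → G} {c₀ : A} {S T U : Finset G}

/-- `6` is a half in `ZMod 11`. [folklore] -/
theorem half_zmod11 : (6 : ZMod 11) + 6 = 1 := by decide

namespace ZpZpDomino

/-- **Every value function of sum `5` on `ZMod 11 × ZMod 11` (as `121` values) in normal form has a line direction
whose count vector is, up to a unit scaling of `ZMod 11`, a certified entry of the canonical table.** [folklore] -/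
theorem exists_table_entry_11_5 (g : Fin (11 * 11) → ℕ) (hg : ∑ i, g i = 5)
    (hNF : (1 ≤ g ⟨11, by decide⟩ ∧ 1 ≤ g ⟨1, by decide⟩) ∨
      (1 ≤ g ⟨11, by decide⟩ ∧ ∀ i : Fin (11 * 11), i.val % 11 ≠ 0 → g i = 0) ∨ (∀ i : Fin (11 * 11), i.val ≠ 0 → g i = 0)) :
    ∃ j < 11 + 1, ∃ k : ℕ, k % 11 ≠ 0 ∧ ∃ e ∈ tableZ11d5c, ∀ v < 11,
      e.1.getD (k * v % 11) 0 = ∑ i : Fin (11 * 11), pick v (pv 11 j i.val) (g i) := by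
  refine exists_entry_of_cover_scaled prime11 tableZ11d5c passTreeZ11d5 tabTreeZ11d5 (fun _ h => mem_tabTreeI h)
    passTreeZ11d5_sound (K := 2) (m := 13) (by norm_num)
    (fun k hk => ?_) cover_11_5_nf2 cover_11_5_nf3 ⟨11, by decide⟩ ⟨1, by decide⟩ rfl rfl g hg hNF
  interval_cases k
  · exact cover_11_5_nf1_0
  · exact cover_11_5_nf1_1
  · exact cover_11_5_nf1_2
  · exact cover_11_5_nf1_3
  · exact cover_11_5_nf1_4
  · exact cover_11_5_nf1_5
  · exact cover_11_5_nf1_6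
  · exact cover_11_5_nf1_7
  · exact cover_11_5_nf1_8
  · exact cover_11_5_nf1_9
  · exact cover_11_5_nf1_10
  · exact cover_11_5_nf1_11
  · exact cover_11_5_nf1_12

end ZpZpDomino

/-- The cover hypothesis of `DominoZpZpCells` for `p = 11` and the part sizes with a kernel enumeration. [folklore] -/
theorem exists_cover_z11z11 {d : ℕ} (hd : d = 3 ∨ d = 4 ∨ d = 5) :
    ∃ Tb : List (List ℕ × List (ℕ × List ℕ)), (∀ e ∈ Tb, lineCert 11 (vecFn e.1) e.2 = true) ∧
      ∀ g : Fin (11 * 11) → ℕ, ∑ i, g i = d →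
        ((1 ≤ g ⟨11, by decide⟩ ∧ 1 ≤ g ⟨1, by decide⟩) ∨ (1 ≤ g ⟨11, by decide⟩ ∧ ∀ i : Fin (11 * 11), i.val % 11 ≠ 0 → g i = 0) ∨
          (∀ i : Fin (11 * 11), i.val ≠ 0 → g i = 0)) →
        ∃ j < 11 + 1, ∃ k : ℕ, k % 11 ≠ 0 ∧ ∃ e ∈ Tb, ∀ v < 11,
          e.1.getD (k * v % 11) 0 = ∑ i : Fin (11 * 11), pick v (pv 11 j i.val) (g i) := by
  haveI : Fact (Nat.Prime 11) := ⟨prime11⟩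
  rcases hd with rfl | hd
  · exact ⟨tableZ11d3c, tableZ11d3c_cert, exists_table_entry_11_3⟩
  rcases hd with rfl | hd
  · exact ⟨tableZ11d4c, tableZ11d4c_cert, exists_table_entry_11_4⟩
  · subst hd
    exact ⟨tableZ11d5c, tableZ11d5c_cert, exists_table_entry_11_5⟩

/-- **No `(1,1 | d,d | e,e)` law triple over `A ↠ ℤ_11 × ℤ_11` for `d ∈ {3, 4, 5}`**: dihedral-like `G` over `A` (any
`c₀`), `φ : A →+ ZMod 11 × ZMod 11` onto, TPP triple with coset parts `|S₀| = |S₁| = 1`, `|T₀| = |T₁| = d`, `|U₀| = |U₁|` ⇒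
`3|S||T||U| + 8 ≠ 8|A|`. [folklore] -/
theorem no_law_cube_1de_of_onto_z11z11 {d : ℕ} (hd : d = 3 ∨ d = 4 ∨ d = 5)
    (hρρ : ∀ a b, ρ a * ρ b = ρ (a + b)) (hρτ : ∀ a b, ρ a * τ b = τ (b - a))
    (hτρ : ∀ a b, τ a * ρ b = τ (a + b)) (hττ : ∀ a b, τ a * τ b = ρ (c₀ + b - a))
    (hρ : Function.Injective ρ) (hτ : Function.Injective τ) (hne : ∀ a b, ρ a ≠ τ b)
    (hsurj : ∀ g, (∃ a, ρ a = g) ∨ (∃ a, τ a = g))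
    (φ : A →+ ZMod 11 × ZMod 11) (hφ : Function.Surjective φ)
    (h : TripleProductProperty S T U)
    (hS₀ : (univ.filter fun a : A => ρ a ∈ S).card = 1) (hS₁ : (univ.filter fun a : A => τ a ∈ S).card = 1)
    (hT₀ : (univ.filter fun a : A => ρ a ∈ T).card = d) (hT₁ : (univ.filter fun a : A => τ a ∈ T).card = d)
    (hU : (univ.filter fun a : A => ρ a ∈ U).card = (univ.filter fun a : A => τ a ∈ U).card)
    (hV : 3 * (S.card * T.card * U.card) + 8 = 8 * Fintype.card A) : False := by
  haveI : Fact (Nat.Prime 11) := ⟨prime11⟩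
  obtain ⟨Tb, hTb, hcov⟩ := exists_cover_z11z11 hd
  exact no_law_cube_1de_of_onto_zpzp_of_cover (6 : ZMod 11) half_zmod11 Tb hTb ⟨11, by decide⟩ ⟨1, by decide⟩ rfl rfl hcov
    hρρ hρτ hτρ hττ hρ hτ hne hsurj φ hφ h hS₀ hS₁ hT₀ hT₁ hU hV

/-- **No `(1,1 | d,d | e,e)` law triple over `A ↠ ℤ_11 × ℤ_11` for `e ∈ {3, 4, 5}`** (the small parts in `U`).
[folklore] -/
theorem no_law_cube_1d_e_of_onto_z11z11 {e : ℕ} (he : e = 3 ∨ e = 4 ∨ e = 5)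
    (hρρ : ∀ a b, ρ a * ρ b = ρ (a + b)) (hρτ : ∀ a b, ρ a * τ b = τ (b - a))
    (hτρ : ∀ a b, τ a * ρ b = τ (a + b)) (hττ : ∀ a b, τ a * τ b = ρ (c₀ + b - a))
    (hρ : Function.Injective ρ) (hτ : Function.Injective τ) (hne : ∀ a b, ρ a ≠ τ b)
    (hsurj : ∀ g, (∃ a, ρ a = g) ∨ (∃ a, τ a = g))
    (φ : A →+ ZMod 11 × ZMod 11) (hφ : Function.Surjective φ)
    (h : TripleProductProperty S T U)
    (hS₀ : (univ.filter fun a : A => ρ a ∈ S).card = 1) (hS₁ : (univ.filter fun a : A => τ a ∈ S).card = 1)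
    (hT : (univ.filter fun a : A => ρ a ∈ T).card = (univ.filter fun a : A => τ a ∈ T).card)
    (hU₀ : (univ.filter fun a : A => ρ a ∈ U).card = e) (hU₁ : (univ.filter fun a : A => τ a ∈ U).card = e)
    (hV : 3 * (S.card * T.card * U.card) + 8 = 8 * Fintype.card A) : False := by
  haveI : Fact (Nat.Prime 11) := ⟨prime11⟩
  obtain ⟨Tb, hTb, hcov⟩ := exists_cover_z11z11 he
  exact no_law_cube_1d_e_of_onto_zpzp_of_cover (6 : ZMod 11) half_zmod11 Tb hTb ⟨11, by decide⟩ ⟨1, by decide⟩ rfl rfl hcov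
    hρρ hρτ hτρ hττ hρ hτ hne hsurj φ hφ h hS₀ hS₁ hT hU₀ hU₁ hV

/-- **Cell form `(1, 3, e)` over `A ↠ ℤ_11²**: no TPP triple with parts `(1,1 | 3,3 | e,e)` attains the mod-one law.
[folklore] -/
theorem no_law_cube_13e_of_onto_z11z11
    (hρρ : ∀ a b, ρ a * ρ b = ρ (a + b)) (hρτ : ∀ a b, ρ a * τ b = τ (b - a))
    (hτρ : ∀ a b, τ a * ρ b = τ (a + b)) (hττ : ∀ a b, τ a * τ b = ρ (c₀ + b - a))
    (hρ : Function.Injective ρ) (hτ : Function.Injective τ) (hne : ∀ a b, ρ a ≠ τ b)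
    (hsurj : ∀ g, (∃ a, ρ a = g) ∨ (∃ a, τ a = g))
    (φ : A →+ ZMod 11 × ZMod 11) (hφ : Function.Surjective φ)
    (h : TripleProductProperty S T U)
    (hS₀ : (univ.filter fun a : A => ρ a ∈ S).card = 1) (hS₁ : (univ.filter fun a : A => τ a ∈ S).card = 1)
    (hT₀ : (univ.filter fun a : A => ρ a ∈ T).card = 3) (hT₁ : (univ.filter fun a : A => τ a ∈ T).card = 3)
    (hU : (univ.filter fun a : A => ρ a ∈ U).card = (univ.filter fun a : A => τ a ∈ U).card)
    (hV : 3 * (S.card * T.card * U.card) + 8 = 8 * Fintype.card A) : False :=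
  no_law_cube_1de_of_onto_z11z11 (Or.inl rfl) hρρ hρτ hτρ hττ hρ hτ hne hsurj φ hφ h hS₀ hS₁ hT₀ hT₁ hU hV

/-- **Cell form `(1, d, 3)`** over `A ↠ ℤ_11²` (the parts `3` in `U`). [folklore] -/
theorem no_law_cube_1d3_of_onto_z11z11
    (hρρ : ∀ a b, ρ a * ρ b = ρ (a + b)) (hρτ : ∀ a b, ρ a * τ b = τ (b - a))
    (hτρ : ∀ a b, τ a * ρ b = τ (a + b)) (hττ : ∀ a b, τ a * τ b = ρ (c₀ + b - a))
    (hρ : Function.Injective ρ) (hτ : Function.Injective τ) (hne : ∀ a b, ρ a ≠ τ b)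
    (hsurj : ∀ g, (∃ a, ρ a = g) ∨ (∃ a, τ a = g))
    (φ : A →+ ZMod 11 × ZMod 11) (hφ : Function.Surjective φ)
    (h : TripleProductProperty S T U)
    (hS₀ : (univ.filter fun a : A => ρ a ∈ S).card = 1) (hS₁ : (univ.filter fun a : A => τ a ∈ S).card = 1)
    (hT : (univ.filter fun a : A => ρ a ∈ T).card = (univ.filter fun a : A => τ a ∈ T).card)
    (hU₀ : (univ.filter fun a : A => ρ a ∈ U).card = 3) (hU₁ : (univ.filter fun a : A => τ a ∈ U).card = 3)
    (hV : 3 * (S.card * T.card * U.card) + 8 = 8 * Fintype.card A) : False :=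
  no_law_cube_1d_e_of_onto_z11z11 (Or.inl rfl) hρρ hρτ hτρ hττ hρ hτ hne hsurj φ hφ h hS₀ hS₁ hT hU₀ hU₁ hV

/-- **Cell form `(1, 4, e)` over `A ↠ ℤ_11²**: no TPP triple with parts `(1,1 | 4,4 | e,e)` attains the mod-one law.
[folklore] -/
theorem no_law_cube_14e_of_onto_z11z11
    (hρρ : ∀ a b, ρ a * ρ b = ρ (a + b)) (hρτ : ∀ a b, ρ a * τ b = τ (b - a))
    (hτρ : ∀ a b, τ a * ρ b = τ (a + b)) (hττ : ∀ a b, τ a * τ b = ρ (c₀ + b - a))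
    (hρ : Function.Injective ρ) (hτ : Function.Injective τ) (hne : ∀ a b, ρ a ≠ τ b)
    (hsurj : ∀ g, (∃ a, ρ a = g) ∨ (∃ a, τ a = g))
    (φ : A →+ ZMod 11 × ZMod 11) (hφ : Function.Surjective φ)
    (h : TripleProductProperty S T U)
    (hS₀ : (univ.filter fun a : A => ρ a ∈ S).card = 1) (hS₁ : (univ.filter fun a : A => τ a ∈ S).card = 1)
    (hT₀ : (univ.filter fun a : A => ρ a ∈ T).card = 4) (hT₁ : (univ.filter fun a : A => τ a ∈ T).card = 4)
    (hU : (univ.filter fun a : A => ρ a ∈ U).card = (univ.filter fun a : A => τ a ∈ U).card)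
    (hV : 3 * (S.card * T.card * U.card) + 8 = 8 * Fintype.card A) : False :=
  no_law_cube_1de_of_onto_z11z11 (Or.inr (Or.inl rfl)) hρρ hρτ hτρ hττ hρ hτ hne hsurj φ hφ h hS₀ hS₁ hT₀ hT₁ hU hV

/-- **Cell form `(1, d, 4)`** over `A ↠ ℤ_11²` (the parts `4` in `U`). [folklore] -/
theorem no_law_cube_1d4_of_onto_z11z11
    (hρρ : ∀ a b, ρ a * ρ b = ρ (a + b)) (hρτ : ∀ a b, ρ a * τ b = τ (b - a))
    (hτρ : ∀ a b, τ a * ρ b = τ (a + b)) (hττ : ∀ a b, τ a * τ b = ρ (c₀ + b - a))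
    (hρ : Function.Injective ρ) (hτ : Function.Injective τ) (hne : ∀ a b, ρ a ≠ τ b)
    (hsurj : ∀ g, (∃ a, ρ a = g) ∨ (∃ a, τ a = g))
    (φ : A →+ ZMod 11 × ZMod 11) (hφ : Function.Surjective φ)
    (h : TripleProductProperty S T U)
    (hS₀ : (univ.filter fun a : A => ρ a ∈ S).card = 1) (hS₁ : (univ.filter fun a : A => τ a ∈ S).card = 1)
    (hT : (univ.filter fun a : A => ρ a ∈ T).card = (univ.filter fun a : A => τ a ∈ T).card)
    (hU₀ : (univ.filter fun a : A => ρ a ∈ U).card = 4) (hU₁ : (univ.filter fun a : A => τ a ∈ U).card = 4)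
    (hV : 3 * (S.card * T.card * U.card) + 8 = 8 * Fintype.card A) : False :=
  no_law_cube_1d_e_of_onto_z11z11 (Or.inr (Or.inl rfl)) hρρ hρτ hτρ hττ hρ hτ hne hsurj φ hφ h hS₀ hS₁ hT hU₀ hU₁ hV

/-- **Cell form `(1, 5, e)` over `A ↠ ℤ_11²**: no TPP triple with parts `(1,1 | 5,5 | e,e)` attains the mod-one law.
[folklore] -/
theorem no_law_cube_15e_of_onto_z11z11
    (hρρ : ∀ a b, ρ a * ρ b = ρ (a + b)) (hρτ : ∀ a b, ρ a * τ b = τ (b - a))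
    (hτρ : ∀ a b, τ a * ρ b = τ (a + b)) (hττ : ∀ a b, τ a * τ b = ρ (c₀ + b - a))
    (hρ : Function.Injective ρ) (hτ : Function.Injective τ) (hne : ∀ a b, ρ a ≠ τ b)
    (hsurj : ∀ g, (∃ a, ρ a = g) ∨ (∃ a, τ a = g))
    (φ : A →+ ZMod 11 × ZMod 11) (hφ : Function.Surjective φ)
    (h : TripleProductProperty S T U)
    (hS₀ : (univ.filter fun a : A => ρ a ∈ S).card = 1) (hS₁ : (univ.filter fun a : A => τ a ∈ S).card = 1)
    (hT₀ : (univ.filter fun a : A => ρ a ∈ T).card = 5) (hT₁ : (univ.filter fun a : A => τ a ∈ T).card = 5)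
    (hU : (univ.filter fun a : A => ρ a ∈ U).card = (univ.filter fun a : A => τ a ∈ U).card)
    (hV : 3 * (S.card * T.card * U.card) + 8 = 8 * Fintype.card A) : False :=
  no_law_cube_1de_of_onto_z11z11 (Or.inr (Or.inr rfl)) hρρ hρτ hτρ hττ hρ hτ hne hsurj φ hφ h hS₀ hS₁ hT₀ hT₁ hU hV

/-- **Cell form `(1, d, 5)`** over `A ↠ ℤ_11²` (the parts `5` in `U`). [folklore] -/
theorem no_law_cube_1d5_of_onto_z11z11
    (hρρ : ∀ a b, ρ a * ρ b = ρ (a + b)) (hρτ : ∀ a b, ρ a * τ b = τ (b - a))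
    (hτρ : ∀ a b, τ a * ρ b = τ (a + b)) (hττ : ∀ a b, τ a * τ b = ρ (c₀ + b - a))
    (hρ : Function.Injective ρ) (hτ : Function.Injective τ) (hne : ∀ a b, ρ a ≠ τ b)
    (hsurj : ∀ g, (∃ a, ρ a = g) ∨ (∃ a, τ a = g))
    (φ : A →+ ZMod 11 × ZMod 11) (hφ : Function.Surjective φ)
    (h : TripleProductProperty S T U)
    (hS₀ : (univ.filter fun a : A => ρ a ∈ S).card = 1) (hS₁ : (univ.filter fun a : A => τ a ∈ S).card = 1)
    (hT : (univ.filter fun a : A => ρ a ∈ T).card = (univ.filter fun a : A => τ a ∈ T).card)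
    (hU₀ : (univ.filter fun a : A => ρ a ∈ U).card = 5) (hU₁ : (univ.filter fun a : A => τ a ∈ U).card = 5)
    (hV : 3 * (S.card * T.card * U.card) + 8 = 8 * Fintype.card A) : False :=
  no_law_cube_1d_e_of_onto_z11z11 (Or.inr (Or.inr rfl)) hρρ hρτ hτρ hττ hρ hτ hne hsurj φ hφ h hS₀ hS₁ hT hU₀ hU₁ hV

end Summit.MatrixMultiplication.OmegaCensus
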